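import Summits.QuantumFields.YangMills.Theorems.ParabolicTrajectoryContinuumLimitOnTrajectoryUclDefs
import Literature.MathematicalPhysics.QuantumLattice.SchwartzHalfSpaceCutoffC

/-!
# Crux `ContinuumLimitOnTrajectory` (stmt-QuantumFields-10522), line `two-orbit-synchronisation` (seat c2):
# tail terms of the core clustering estimate — part A: the six pieces

Helper file (`--supports stmt-QuantumFields-10522`) for the registered stub `stub_uclOfGap : UCLOfGap`, wave 2,
worker W2-TAILS. The nine-term expansion of the truncated two-block functional `covc r sch k X Y = cD (X ⊗ Y) − cD X · cD Y`
(`…UclAlg`) runs along the three-piece decompositions `X = lowMain + lowMid + lowFar`, `Y = upMain + upMid + upFar`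
(`…UclDefs`, half-space cutoffs `cutLE 0`, `cutGE 0` in the time coordinate). This file records what the tail estimates need
to know about the six pieces:

* SUPPORTS: each piece is supported inside its factor (`tsupport_lowMain_subset`, …), so pieces of locus-avoiding factors avoid
  the locus, and so do appended PAIRS of pieces (`avoidsLocus_appendTensor_mono`: `supp (X' ⊗ Y') ⊆ supp (X ⊗ Y)` — closure of
  a product is the product of closures, `append_mem_tsupport_appendTensor`) — the off-diagonality inputs of `UUVB`;
* SCHWARTZ NORMS (from the cutoff kit `SchwartzHalfSpaceCutoffC`): uniform bounds `|piece|_M ≤ C |factor|_M`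
  (`exists_bound_lowMain/lowMid/upMain/upMid/upFar`) and decaying ones — `|lowMid|_M ≤ C (s₀/4)^{-N} |X|_{M+N}`,
  `|lowFar|_M ≤ C ρ^{-N} |X|_{M+N}`, `|upFar|_M ≤ C (s₀+ρ)^{-N} |Y|_{M+N}`, and for the translated upper factor `Y = T_{tb} Up`,
  `s₀ = t b₀`: `|upMid ρ s₀ Y|_M ≤ C (2(1+‖tb‖))^M (s₀/4)^{-N} |Up|_{M+N}` (the cut commutes with the translation,
  `sub_cutGE_translateMulti`, and `|T_a F|_M ≤ (2(1+‖a‖))^M |F|_M`).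

Refs: Osterwalder–Schrader 1973 §2; Hörmander ALPDO I §7.1.
-/

set_option autoImplicit false

open scoped SchwartzMap
open MeasureTheory Filter Topology Set
open Literature.MathematicalPhysics.QuantumFieldTheory Literature.MathematicalPhysics.QuantumLattice
open Literature.MathematicalPhysics.AQFT Literature.Probability.LatticeModels

noncomputable section

namespace Summit.QuantumFields.YangMills.Cruxes.ContinuumLimitOnTrajectory.TwoOrbitSynchronisation

namespace Tails

/-! ## Supports: appended tensors of shrunken factors -/

section Supports

variable {E : Type*} [NormedAddCommGroup E] [NormedSpace ℝ E] {n m : ℕ}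

/-- Appending a support point of `F` and one of `G'` gives a support point of `F ⊗ G'`. -/
theorem append_mem_tsupport_appendTensor (F : 𝓢((Fin n → E), ℂ)) (G' : 𝓢((Fin m → E), ℂ)) {xl : Fin n → E}
    {xr : Fin m → E} (hl : xl ∈ tsupport (F : (Fin n → E) → ℂ)) (hr : xr ∈ tsupport (G' : (Fin m → E) → ℂ)) :
    Fin.append xl xr ∈ tsupport (F.appendTensor G' : (Fin (n + m) → E) → ℂ) := by
  refine map_mem_closure₂ (f := fun (u : Fin n → E) (v : Fin m → E) => Fin.append u v)
    (Fin.continuous_append n m) hl hr fun u hu v hv => ?_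
  rw [Function.mem_support] at hu hv ⊢
  have h1 : Fin.append u v ∘ Fin.castAdd m = u := funext fun i => Fin.append_left u v i
  have h2 : Fin.append u v ∘ Fin.natAdd n = v := funext fun i => Fin.append_right u v i
  rw [SchwartzMap.appendTensor_apply, h1, h2]
  exact mul_ne_zero hu hv

/-- **Shrinking both factors preserves locus-avoidance of the appended tensor.** -/
theorem avoidsLocus_appendTensor_mono {X X' : 𝓢((Fin n → E), ℂ)} {Y Y' : 𝓢((Fin m → E), ℂ)}
    (h : AvoidsLocus (X.appendTensor Y)) (hX : tsupport (X' : (Fin n → E) → ℂ) ⊆ tsupport (X : (Fin n → E) → ℂ))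
    (hY : tsupport (Y' : (Fin m → E) → ℂ) ⊆ tsupport (Y : (Fin m → E) → ℂ)) : AvoidsLocus (X'.appendTensor Y') := by
  intro x hx
  obtain ⟨h1, h2⟩ := tsupport_appendTensor_subset_preimage X' Y' hx
  have h3 := append_mem_tsupport_appendTensor X Y (hX h1) (hY h2)
  have h4 : Fin.append (x ∘ Fin.castAdd m) (x ∘ Fin.natAdd n) = x := Fin.append_castAdd_natAdd (f := x)
  rw [h4] at h3
  exact h h3

end Supports

/-! ## The six pieces: supports and Schwartz-norm bounds -/

section Pieces

variable {p : ℕ}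

/-- `supp lowMain ⊆ supp X`. -/
theorem tsupport_lowMain_subset (ρ s₀ : ℝ) (X : 𝓢((Fin p → EuclideanSpace ℝ (Fin 4)), ℂ)) :
    tsupport (lowMain ρ s₀ X : (Fin p → EuclideanSpace ℝ (Fin 4)) → ℂ) ⊆
      tsupport (X : (Fin p → EuclideanSpace ℝ (Fin 4)) → ℂ) := by
  unfold lowMain
  exact ((tsupport_cutGE_subset 0 (-ρ) _).trans inter_subset_left).trans
    ((tsupport_cutLE_subset 0 (s₀ / 4) X).trans inter_subset_left)

/-- `supp lowMid ⊆ supp X`. -/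
theorem tsupport_lowMid_subset (ρ s₀ : ℝ) (X : 𝓢((Fin p → EuclideanSpace ℝ (Fin 4)), ℂ)) :
    tsupport (lowMid ρ s₀ X : (Fin p → EuclideanSpace ℝ (Fin 4)) → ℂ) ⊆
      tsupport (X : (Fin p → EuclideanSpace ℝ (Fin 4)) → ℂ) := by
  unfold lowMid
  exact ((tsupport_cutGE_subset 0 (-ρ) _).trans inter_subset_left).trans
    ((tsupport_sub_cutLE_subset 0 (s₀ / 4) X).trans inter_subset_left)

/-- `supp lowFar ⊆ supp X`. -/
theorem tsupport_lowFar_subset (ρ : ℝ) (X : 𝓢((Fin p → EuclideanSpace ℝ (Fin 4)), ℂ)) :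
    tsupport (lowFar ρ X : (Fin p → EuclideanSpace ℝ (Fin 4)) → ℂ) ⊆
      tsupport (X : (Fin p → EuclideanSpace ℝ (Fin 4)) → ℂ) := by
  unfold lowFar
  exact (tsupport_sub_cutGE_subset 0 (-ρ) X).trans inter_subset_left

/-- `supp upMain ⊆ supp Y`. -/
theorem tsupport_upMain_subset (ρ s₀ : ℝ) (Y : 𝓢((Fin p → EuclideanSpace ℝ (Fin 4)), ℂ)) :
    tsupport (upMain ρ s₀ Y : (Fin p → EuclideanSpace ℝ (Fin 4)) → ℂ) ⊆
      tsupport (Y : (Fin p → EuclideanSpace ℝ (Fin 4)) → ℂ) := by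
  unfold upMain
  exact ((tsupport_cutLE_subset 0 (s₀ + ρ) _).trans inter_subset_left).trans
    ((tsupport_cutGE_subset 0 (3 * s₀ / 4) Y).trans inter_subset_left)

/-- `supp upMid ⊆ supp Y`. -/
theorem tsupport_upMid_subset (ρ s₀ : ℝ) (Y : 𝓢((Fin p → EuclideanSpace ℝ (Fin 4)), ℂ)) :
    tsupport (upMid ρ s₀ Y : (Fin p → EuclideanSpace ℝ (Fin 4)) → ℂ) ⊆
      tsupport (Y : (Fin p → EuclideanSpace ℝ (Fin 4)) → ℂ) := by
  unfold upMid
  exact ((tsupport_cutLE_subset 0 (s₀ + ρ) _).trans inter_subset_left).trans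
    ((tsupport_sub_cutGE_subset 0 (3 * s₀ / 4) Y).trans inter_subset_left)

/-- `supp upFar ⊆ supp Y`. -/
theorem tsupport_upFar_subset (ρ s₀ : ℝ) (Y : 𝓢((Fin p → EuclideanSpace ℝ (Fin 4)), ℂ)) :
    tsupport (upFar ρ s₀ Y : (Fin p → EuclideanSpace ℝ (Fin 4)) → ℂ) ⊆
      tsupport (Y : (Fin p → EuclideanSpace ℝ (Fin 4)) → ℂ) := by
  unfold upFar
  exact (tsupport_sub_cutLE_subset 0 (s₀ + ρ) Y).trans inter_subset_left

variable (p)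

/-- `|lowMain|_M ≤ C |X|_M`, uniformly in the thresholds. -/
theorem exists_bound_lowMain (M : ℕ) : ∃ C : ℝ, 0 ≤ C ∧ ∀ (ρ s₀ : ℝ) (X : 𝓢((Fin p → EuclideanSpace ℝ (Fin 4)), ℂ)),
    schwartzNorm M (lowMain ρ s₀ X) ≤ C * schwartzNorm M X := by
  obtain ⟨C₁, h₁0, h₁⟩ := exists_bound_schwartzNorm_cutLE (p := p) (0 : Fin 4) M
  obtain ⟨C₂, h₂0, h₂⟩ := exists_bound_schwartzNorm_cutGE (p := p) (0 : Fin 4) M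
  refine ⟨C₂ * C₁, mul_nonneg h₂0 h₁0, fun ρ s₀ X => ?_⟩
  unfold lowMain
  calc schwartzNorm M (cutGE 0 (-ρ) (cutLE 0 (s₀ / 4) X)) ≤ C₂ * schwartzNorm M (cutLE 0 (s₀ / 4) X) := h₂ _ _
    _ ≤ C₂ * (C₁ * schwartzNorm M X) := mul_le_mul_of_nonneg_left (h₁ _ X) h₂0
    _ = C₂ * C₁ * schwartzNorm M X := (mul_assoc _ _ _).symm

/-- `|lowMid|_M ≤ C |X|_M`, uniformly in the thresholds. -/
theorem exists_bound_lowMid (M : ℕ) : ∃ C : ℝ, 0 ≤ C ∧ ∀ (ρ s₀ : ℝ) (X : 𝓢((Fin p → EuclideanSpace ℝ (Fin 4)), ℂ)),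
    schwartzNorm M (lowMid ρ s₀ X) ≤ C * schwartzNorm M X := by
  obtain ⟨C₁, h₁0, h₁⟩ := exists_bound_schwartzNorm_sub_cutLE_uniform (p := p) (0 : Fin 4) M
  obtain ⟨C₂, h₂0, h₂⟩ := exists_bound_schwartzNorm_cutGE (p := p) (0 : Fin 4) M
  refine ⟨C₂ * C₁, mul_nonneg h₂0 h₁0, fun ρ s₀ X => ?_⟩
  unfold lowMid
  calc schwartzNorm M (cutGE 0 (-ρ) (X - cutLE 0 (s₀ / 4) X)) ≤ C₂ * schwartzNorm M (X - cutLE 0 (s₀ / 4) X) := h₂ _ _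
    _ ≤ C₂ * (C₁ * schwartzNorm M X) := mul_le_mul_of_nonneg_left (h₁ _ X) h₂0
    _ = C₂ * C₁ * schwartzNorm M X := (mul_assoc _ _ _).symm

/-- `|lowMid|_M ≤ C (s₀/4)^{-N} |X|_{M+N}` for `s₀ > 0`. -/
theorem exists_decay_lowMid (M N : ℕ) : ∃ C : ℝ, 0 ≤ C ∧ ∀ (ρ s₀ : ℝ) (X : 𝓢((Fin p → EuclideanSpace ℝ (Fin 4)), ℂ)), 0 < s₀ →
    schwartzNorm M (lowMid ρ s₀ X) ≤ C * (s₀ / 4)⁻¹ ^ N * schwartzNorm (M + N) X := by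
  obtain ⟨C₁, h₁0, h₁⟩ := exists_bound_schwartzNorm_sub_cutLE (p := p) (0 : Fin 4) M N
  obtain ⟨C₂, h₂0, h₂⟩ := exists_bound_schwartzNorm_cutGE (p := p) (0 : Fin 4) M
  refine ⟨C₂ * C₁, mul_nonneg h₂0 h₁0, fun ρ s₀ X hs => ?_⟩
  unfold lowMid
  calc schwartzNorm M (cutGE 0 (-ρ) (X - cutLE 0 (s₀ / 4) X)) ≤ C₂ * schwartzNorm M (X - cutLE 0 (s₀ / 4) X) := h₂ _ _
    _ ≤ C₂ * (C₁ * (s₀ / 4)⁻¹ ^ N * schwartzNorm (M + N) X) :=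
        mul_le_mul_of_nonneg_left (h₁ _ (by positivity) X) h₂0
    _ = C₂ * C₁ * (s₀ / 4)⁻¹ ^ N * schwartzNorm (M + N) X := by ring

/-- `|lowFar|_M ≤ C ρ^{-N} |X|_{M+N}` for `ρ > 0`. -/
theorem exists_decay_lowFar (M N : ℕ) : ∃ C : ℝ, 0 ≤ C ∧ ∀ (ρ : ℝ) (X : 𝓢((Fin p → EuclideanSpace ℝ (Fin 4)), ℂ)), 0 < ρ →
    schwartzNorm M (lowFar ρ X) ≤ C * ρ⁻¹ ^ N * schwartzNorm (M + N) X := by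
  obtain ⟨C₁, h₁0, h₁⟩ := exists_bound_schwartzNorm_sub_cutGE (p := p) (0 : Fin 4) M N
  refine ⟨C₁, h₁0, fun ρ X hρ => ?_⟩
  unfold lowFar
  have h := h₁ (-ρ) (by linarith) X
  rwa [abs_neg, abs_of_pos hρ] at h

/-- `|upMain|_M ≤ C |Y|_M`, uniformly in the thresholds. -/
theorem exists_bound_upMain (M : ℕ) : ∃ C : ℝ, 0 ≤ C ∧ ∀ (ρ s₀ : ℝ) (Y : 𝓢((Fin p → EuclideanSpace ℝ (Fin 4)), ℂ)),
    schwartzNorm M (upMain ρ s₀ Y) ≤ C * schwartzNorm M Y := by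
  obtain ⟨C₁, h₁0, h₁⟩ := exists_bound_schwartzNorm_cutLE (p := p) (0 : Fin 4) M
  obtain ⟨C₂, h₂0, h₂⟩ := exists_bound_schwartzNorm_cutGE (p := p) (0 : Fin 4) M
  refine ⟨C₁ * C₂, mul_nonneg h₁0 h₂0, fun ρ s₀ Y => ?_⟩
  unfold upMain
  calc schwartzNorm M (cutLE 0 (s₀ + ρ) (cutGE 0 (3 * s₀ / 4) Y)) ≤ C₁ * schwartzNorm M (cutGE 0 (3 * s₀ / 4) Y) := h₁ _ _
    _ ≤ C₁ * (C₂ * schwartzNorm M Y) := mul_le_mul_of_nonneg_left (h₂ _ Y) h₁0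
    _ = C₁ * C₂ * schwartzNorm M Y := (mul_assoc _ _ _).symm

/-- `|upMid|_M ≤ C |Y|_M`, uniformly in the thresholds. -/
theorem exists_bound_upMid (M : ℕ) : ∃ C : ℝ, 0 ≤ C ∧ ∀ (ρ s₀ : ℝ) (Y : 𝓢((Fin p → EuclideanSpace ℝ (Fin 4)), ℂ)),
    schwartzNorm M (upMid ρ s₀ Y) ≤ C * schwartzNorm M Y := by
  obtain ⟨C₁, h₁0, h₁⟩ := exists_bound_schwartzNorm_cutLE (p := p) (0 : Fin 4) M
  obtain ⟨C₂, h₂0, h₂⟩ := exists_bound_schwartzNorm_sub_cutGE_uniform (p := p) (0 : Fin 4) M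
  refine ⟨C₁ * C₂, mul_nonneg h₁0 h₂0, fun ρ s₀ Y => ?_⟩
  unfold upMid
  calc schwartzNorm M (cutLE 0 (s₀ + ρ) (Y - cutGE 0 (3 * s₀ / 4) Y)) ≤ C₁ * schwartzNorm M (Y - cutGE 0 (3 * s₀ / 4) Y) :=
        h₁ _ _
    _ ≤ C₁ * (C₂ * schwartzNorm M Y) := mul_le_mul_of_nonneg_left (h₂ _ Y) h₁0
    _ = C₁ * C₂ * schwartzNorm M Y := (mul_assoc _ _ _).symm

/-- **Decay of the translated mid piece**: for `Y = T_{tb} Up` and `s₀ = t b₀ > 0`,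
`|upMid ρ s₀ Y|_M ≤ C (2(1+‖tb‖))^M (s₀/4)^{-N} |Up|_{M+N}` (the cut commutes with the translation). -/
theorem exists_decay_upMid (M N : ℕ) : ∃ C : ℝ, 0 ≤ C ∧ ∀ (ρ t : ℝ) (b : EuclideanSpace ℝ (Fin 4))
    (Up : 𝓢((Fin p → EuclideanSpace ℝ (Fin 4)), ℂ)), 0 < t * b 0 →
    schwartzNorm M (upMid ρ (t * b 0) (translateMulti (t • b) Up)) ≤
      C * (2 * (1 + ‖t • b‖)) ^ M * (t * b 0 / 4)⁻¹ ^ N * schwartzNorm (M + N) Up := by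
  obtain ⟨C₁, h₁0, h₁⟩ := exists_bound_schwartzNorm_cutLE (p := p) (0 : Fin 4) M
  obtain ⟨C₂, h₂0, h₂⟩ := exists_bound_schwartzNorm_sub_cutGE (p := p) (0 : Fin 4) M N
  refine ⟨C₁ * C₂, mul_nonneg h₁0 h₂0, fun ρ t b Up hs => ?_⟩
  unfold upMid
  have hθ : 3 * (t * b 0) / 4 - (t • b) 0 = -(t * b 0 / 4) := by
    rw [PiLp.smul_apply, smul_eq_mul]; ring
  have hneg : -(t * b 0 / 4) < 0 := by linarith
  have hT : 0 ≤ (2 * (1 + ‖t • b‖)) ^ M := by positivity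
  calc schwartzNorm M (cutLE 0 (t * b 0 + ρ)
        (translateMulti (t • b) Up - cutGE 0 (3 * (t * b 0) / 4) (translateMulti (t • b) Up)))
      ≤ C₁ * schwartzNorm M (translateMulti (t • b) Up - cutGE 0 (3 * (t * b 0) / 4) (translateMulti (t • b) Up)) := h₁ _ _
    _ = C₁ * schwartzNorm M (translateMulti (t • b) (Up - cutGE 0 (-(t * b 0 / 4)) Up)) := by
        rw [sub_cutGE_translateMulti, hθ]
    _ ≤ C₁ * ((2 * (1 + ‖t • b‖)) ^ M * schwartzNorm M (Up - cutGE 0 (-(t * b 0 / 4)) Up)) :=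
        mul_le_mul_of_nonneg_left (schwartzNorm_translateMulti_le M (t • b) _) h₁0
    _ ≤ C₁ * ((2 * (1 + ‖t • b‖)) ^ M * (C₂ * |-(t * b 0 / 4)|⁻¹ ^ N * schwartzNorm (M + N) Up)) :=
        mul_le_mul_of_nonneg_left (mul_le_mul_of_nonneg_left (h₂ _ hneg Up) hT) h₁0
    _ = C₁ * C₂ * (2 * (1 + ‖t • b‖)) ^ M * (t * b 0 / 4)⁻¹ ^ N * schwartzNorm (M + N) Up := by
        rw [abs_neg, abs_of_pos (by positivity : 0 < t * b 0 / 4)]; ring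

/-- `|upFar|_M ≤ C |Y|_M`, uniformly in the thresholds. -/
theorem exists_bound_upFar (M : ℕ) : ∃ C : ℝ, 0 ≤ C ∧ ∀ (ρ s₀ : ℝ) (Y : 𝓢((Fin p → EuclideanSpace ℝ (Fin 4)), ℂ)),
    schwartzNorm M (upFar ρ s₀ Y) ≤ C * schwartzNorm M Y := by
  obtain ⟨C₁, h₁0, h₁⟩ := exists_bound_schwartzNorm_sub_cutLE_uniform (p := p) (0 : Fin 4) M
  exact ⟨C₁, h₁0, fun ρ s₀ Y => h₁ (s₀ + ρ) Y⟩

/-- `|upFar|_M ≤ C (s₀+ρ)^{-N} |Y|_{M+N}` for `s₀ + ρ > 0`. -/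
theorem exists_decay_upFar (M N : ℕ) : ∃ C : ℝ, 0 ≤ C ∧ ∀ (ρ s₀ : ℝ) (Y : 𝓢((Fin p → EuclideanSpace ℝ (Fin 4)), ℂ)), 0 < s₀ + ρ →
    schwartzNorm M (upFar ρ s₀ Y) ≤ C * (s₀ + ρ)⁻¹ ^ N * schwartzNorm (M + N) Y := by
  obtain ⟨C₁, h₁0, h₁⟩ := exists_bound_schwartzNorm_sub_cutLE (p := p) (0 : Fin 4) M N
  exact ⟨C₁, h₁0, fun ρ s₀ Y hs => h₁ (s₀ + ρ) hs Y⟩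

end Pieces

end Tails

/-! ## Registered anchor of this file -/

/-- **Registered anchor — shrinking both factors preserves locus-avoidance of the appended tensor** (the support of
`X' ⊗ Y'` lies in that of `X ⊗ Y` when `supp X' ⊆ supp X`, `supp Y' ⊆ supp Y`: closure of a product is the product of the
closures); this is how every appended pair of cut pieces of `Low ⊗ T_{tb} Up` stays in `⁰𝒮`. -/
theorem tailsA_avoidsLocus_appendTensor_mono :
    ∀ {n m : ℕ} {X X' : 𝓢((Fin n → EuclideanSpace ℝ (Fin 4)), ℂ)} {Y Y' : 𝓢((Fin m → EuclideanSpace ℝ (Fin 4)), ℂ)},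
      AvoidsLocus (X.appendTensor Y) →
      tsupport (X' : (Fin n → EuclideanSpace ℝ (Fin 4)) → ℂ) ⊆ tsupport (X : (Fin n → EuclideanSpace ℝ (Fin 4)) → ℂ) →
      tsupport (Y' : (Fin m → EuclideanSpace ℝ (Fin 4)) → ℂ) ⊆ tsupport (Y : (Fin m → EuclideanSpace ℝ (Fin 4)) → ℂ) →
        AvoidsLocus (X'.appendTensor Y') := by
  intro n m X X' Y Y' h hX hY
  exact Tails.avoidsLocus_appendTensor_mono h hX hY

end Summit.QuantumFields.YangMills.Cruxes.ContinuumLimitOnTrajectory.TwoOrbitSynchronisation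

end
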